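import Literature.NumberTheory.Transcendental.PeriodsWave0
import HarnessLib

/-!
# Lai 2024: `dim_ℚ Span_ℚ(1, ζ(3), ζ(5), …, ζ(s−1)) ≥ 1.009 · log s / (1 + log 2)` (named fact, statement only)

Topic `Literature/NumberTheory/Irrationality/Lai2024`. Typed, cited statement (no proof) read on the page from

* L. Lai, *Small improvements on the Ball–Rivoal theorem and its `p`-adic variant*, arXiv:2407.14236 (v2, 29 Jan
  2025) [Lai2024BallRivoal] (held: `paper:arxiv-2407.14236`, PDF text), p. 2:

  "**Theorem 1.1.** For any sufficiently large even integer `s ≥ s₀`, we have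
  `dim_ℚ Span_ℚ(1, ζ(3), ζ(5), …, ζ(s−1)) ≥ (1.009/(1 + log 2)) · log s`."

  ("Quite unexpectedly, the proof only involves inserting the arithmetic observation of Zudilin (2001) into the
  original proof of Ball–Rivoal. Although this result is covered by a recent development of Fischler (2021+), our
  proof has the advantages of being simple and providing explicit non-vanishing small linear forms in `1` and odd
  zeta values", abstract; "For a considerable period, it was expected that Zudilin's `Φₙ` factor would have a
  negligible impact on asymptotic results as `s → +∞`. The aim of the current paper is to demonstrate that this
  previous expectation is inaccurate", p. 2; "the proofs of Theorem 1.1 and Theorem 1.2 are programming-free",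
  p. 3.)

Context in the tree: Ball–Rivoal's `(1 − ε) log s/(1 + log 2)` is `Literature.NumberTheory.Transcendental.ball_rivoal`
(PROVED, `ball_rivoal_holds`); Fischler's `0.21 √(s/log s)` — which subsumes Theorem 1.1 for large `s`, as the
paper says (p. 3) — is the named fact `Literature.NumberTheory.Irrationality.Fischler2026.oddZetaSpan_finrank_ge_sqrt`;
the `p`-ADIC companion **Theorem 1.2** (`dim_ℚ Span_ℚ(1, ζ_p(3), …, ζ_p(s−1)) ≥ 1.009 log s/(1 + log 2)`, "This is
new, it slightly refines a result of Sprang (2020)") is typed with the other `p`-adic records in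
`Literature/NumberTheory/Irrationality/PAdicZetaValues/Records.lean` (`lai2024_theorem12`). The cell `pub-zeta5`
uses the paper's §§3–4 denominators (`Summit.KontsevichZagierPeriods.Zeta5Search.LaiDenominators`).

NOT typed (deliberately): **Claim 1.3** (the constant `1.119356/(1 + log 2)`, real and `p`-adic) and **Claim 1.4**
(`dim_ℚ Span_ℚ(1, ζ(3), …, ζ(75)) ≥ 3`) — printed as CLAIMS, not theorems: "The proofs of Claim 1.3 and Claim 1.4
involve time-consuming calculations (by computer programming). It is not reasonable to require the referee to check
the correctness of these time-consuming calculations … So we state Claim 1.3 and Claim 1.4 as claims rather than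
theorems" (p. 3); hence not Literature facts (the printed records remain `κ₃ ≤ 139`, Fischler–Zudilin 2010, tree
`FischlerZudilin2010.oddZetaDim139`, and the cell's certified `Zeta5Search` sweeps).

Rendering (as in `FischlerZudilin2010/OddZetaDim139.lean`, `Fischler2026/OddZetaLinearIndependence.lean`):
`ζ(k) = zetaValue k`; the span in the shape of `ball_rivoal` (`insert 1 {ζ(k) : k odd, 3 ≤ k < s}` — for even `s`,
`k ≤ s − 1 ⟺ k < s`); "sufficiently large even `s ≥ s₀`" as `∃ s₀, ∀ s ≥ s₀, Even s → …`.

Cell zeta5-irr / pub-zeta5 (HONEST FRAMING: systematic search; no irrationality claim unless certified): RECORD entry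
(explicit-form Ball–Rivoal with Zudilin's `Φₙ`); nothing here bears on `ζ(5)` itself ("the irrationality of `ζ(5)`
remains an open problem", p. 2).
-/

noncomputable section

namespace Literature.NumberTheory.Irrationality.Lai2024

open Literature.NumberTheory.Transcendental (zetaValue)

/-- **Lai 2024, Theorem 1.1** (named fact, statement only): "For any sufficiently large even integer `s ≥ s₀`, we
have `dim_ℚ Span_ℚ(1, ζ(3), ζ(5), …, ζ(s−1)) ≥ (1.009/(1 + log 2)) · log s`."
[cite: Lai2024BallRivoal, Thm 1.1 (§1, arXiv:2407.14236v2 p. 2)] -/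
def theorem11 : Prop :=
  ∃ s₀ : ℕ, ∀ s : ℕ, s₀ ≤ s → Even s →
    (1.009 : ℝ) / (1 + Real.log 2) * Real.log s ≤
      Module.finrank ℚ
        ↥(Submodule.span ℚ
          (insert (1 : ℝ) {x | ∃ k : ℕ, Odd k ∧ 3 ≤ k ∧ k < s ∧ x = zetaValue k}))

end Literature.NumberTheory.Irrationality.Lai2024
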